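import Mathlib
import Literature.AlgebraicGeometry.Resolution.PolygonChartTransportIndexed
import Literature.AlgebraicGeometry.Resolution.IsolationIndexed
import HarnessLib

/-!
# Transport of Newton points through the chart of the blowing up of the curve `V(y, u₁)` — ARBITRARY embedding dimension

Topic: `Literature/AlgebraicGeometry/Resolution`. Dimension-general form of the transport half of `CurveBlowupPolygonLaws.lean` (`c : Fin 3 → R`):
tenth brick of the generalisation `Fin 3 → Fin (r+2)` of the tree's expansion-free rendering of Hironaka's characteristic polyhedra (memo
`run/shared/lean/pub/res-hironaka/L/res-L1-w42-stub-3/KEYCLAIM-PORT-PLAN.md` §4–§5). Cossart–Jannsen–Saito, LNM 2270, **Lemma 12.4** / Cossart–Piltant 2008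
Lemma 4.5 (1): the blowing up along the regular curve `C = V(y₁, …, y_r, u₁)`, permissible for the idealistic exponent `(J, μ)` (`J ⊆ (y, u₁)^μ`),
read at the point `x′` with parameters `(y′_j = y_j/u₁, u₁, u₂)`. Abstract chart: `φ : R → R′`, `φ y_j = φ u₁ · y′_j` for all `j`,
`c′_{u₁} = φ u₁`, `c′_{u₂} = φ u₂`; weak transform `J′ = (J R′ : (φ u₁)^μ)`. PROVED (ns `WeightedOrder`; the `Fin 3` statements and proofs
verbatim with the y-block in place of `y`):

* `curvePullbackWeight`, `curveExp`, `weight_curveExp`, `map_cmonom_curveChart`, `map_weightedOrderIdeal_le_curve`; `curvePt` (`e` with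
  `e_{u₁} ↦ |e|_y + e_{u₁} − μ`), `curvePt_add_single`, `curvePt_injOn`, `weight_curvePt_add`, `ydeg_curvePt`, `sfac_curvePt`, `spt₂_curvePt`,
  `spt₁_curvePt_add` (`spt₁′ + L = spt₁`: translation by one unit to the left), `map_yu1Ideal_pow_le`, `exists_eq_pow_mul_of_mem_pPow`;
* `colon_le_weightedOrderIdeal_of_le_curve` (containments descend), `isInitialTerm_curveChart` (initial terms go up), `curvePt_mem_pts`.

Sources: V. Cossart, U. Jannsen, S. Saito, LNM **2270** (2020), Lemma 12.4, (12.5) [`CossartJannsenSaito2020`]; V. Cossart, O. Piltant,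
J. Algebra 320 (2008), Lemma 4.5 (1), p. 11 [`CossartPiltant2008`]. No named facts; no instance, notation or attribute.
-/

noncomputable section

open IsLocalRing MvPolynomial

namespace Literature.AlgebraicGeometry.Resolution

namespace WeightedOrder

universe u

/-! ## The curve chart -/

section CurveChart

variable {R R' : Type u} [CommRing R] [CommRing R'] (φ : R →+* R') {r : ℕ} {c : Fin (r + 2) → R}
  {c' : Fin (r + 2) → R'} (hcy : ∀ i : Fin r, φ (c (Fin.castAdd 2 i)) = φ (c (u1 r)) * c' (Fin.castAdd 2 i))
  (hc1 : c' (u1 r) = φ (c (u1 r))) (hc2 : c' (u2 r) = φ (c (u2 r))) (W' : Fin (r + 2) → ℕ)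

/-- The pulled-back weight of the curve chart: `W_{y_j} = W′_{y_j} + W′_{u₁}`, `W_{u₁} = W′_{u₁}`, `W_{u₂} = W′_{u₂}`.
[cite: CossartJannsenSaito2020, (12.5)] -/
def curvePullbackWeight (W' : Fin (r + 2) → ℕ) : Fin (r + 2) → ℕ :=
  fun i => if i = u1 r ∨ i = u2 r then W' i else W' i + W' (u1 r)

/-- Components. [cite: CossartJannsenSaito2020, (12.5)] -/
theorem curvePullbackWeight_y (W' : Fin (r + 2) → ℕ) (i : Fin r) :
    curvePullbackWeight W' (Fin.castAdd 2 i) = W' (Fin.castAdd 2 i) + W' (u1 r) := by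
  simp [curvePullbackWeight, castAdd_ne_u1, castAdd_ne_u2]

/-- Components. [cite: CossartJannsenSaito2020, (12.5)] -/
theorem curvePullbackWeight_u1 (W' : Fin (r + 2) → ℕ) : curvePullbackWeight W' (u1 r) = W' (u1 r) := by
  simp [curvePullbackWeight]

/-- Components. [cite: CossartJannsenSaito2020, (12.5)] -/
theorem curvePullbackWeight_u2 (W' : Fin (r + 2) → ℕ) : curvePullbackWeight W' (u2 r) = W' (u2 r) := by
  simp [curvePullbackWeight]

/-- The pulled-back weight of a positive weight is positive. [cite: CossartJannsenSaito2020, (12.5)] -/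
theorem curvePullbackWeight_pos {W' : Fin (r + 2) → ℕ} (hW' : ∀ i, 0 < W' i) : ∀ i, 0 < curvePullbackWeight W' i := by
  intro i; unfold curvePullbackWeight; split_ifs
  · exact hW' i
  · exact Nat.add_pos_left (hW' i) _

/-- The exponent map of the curve chart: `e` with `e_{u₁} ↦ |e|_y + e_{u₁}`. [cite: CossartJannsenSaito2020, (12.5)] -/
def curveExp (e : Fin (r + 2) →₀ ℕ) : Fin (r + 2) →₀ ℕ :=
  Finsupp.equivFunOnFinite.symm fun i => if i = u1 r then ydeg e + e (u1 r) else e i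

/-- Components. [cite: CossartJannsenSaito2020, (12.5)] -/
theorem curveExp_u1 (e : Fin (r + 2) →₀ ℕ) : curveExp e (u1 r) = ydeg e + e (u1 r) := by simp [curveExp]

/-- Components. [cite: CossartJannsenSaito2020, (12.5)] -/
theorem curveExp_of_ne (e : Fin (r + 2) →₀ ℕ) {i : Fin (r + 2)} (h : i ≠ u1 r) : curveExp e i = e i := by simp [curveExp, h]

/-- The y-degree is unchanged by `curveExp`. [cite: CossartJannsenSaito2020, (12.5)] -/
theorem ydeg_curveExp (e : Fin (r + 2) →₀ ℕ) : ydeg (curveExp e) = ydeg e :=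
  Finset.sum_congr rfl fun i _ => curveExp_of_ne e (castAdd_ne_u1 i)

/-- `curveExp` is injective. [cite: CossartJannsenSaito2020, (12.5)] -/
theorem curveExp_injective : Function.Injective (curveExp (r := r)) := by
  intro e e' h
  have hne : ∀ i, i ≠ u1 r → e i = e' i := fun i hi => by
    have := congrArg (fun m : Fin (r + 2) →₀ ℕ => m i) h
    simpa [curveExp_of_ne _ hi] using this
  have hy' : ydeg e = ydeg e' := Finset.sum_congr rfl fun i _ => hne _ (castAdd_ne_u1 i)
  have hu : ydeg e + e (u1 r) = ydeg e' + e' (u1 r) := by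
    have := congrArg (fun m : Fin (r + 2) →₀ ℕ => m (u1 r)) h
    simpa [curveExp_u1] using this
  ext i
  by_cases hi : i = u1 r
  · subst hi; omega
  · exact hne i hi

/-- The curve chart turns the pulled-back weight into `W′`. [cite: CossartJannsenSaito2020, (12.5)] -/
theorem weight_curveExp (e : Fin (r + 2) →₀ ℕ) :
    Finsupp.weight W' (curveExp e) = Finsupp.weight (curvePullbackWeight W') e := by
  rw [Finsupp.weight_apply, Finsupp.weight_apply, Finsupp.sum_fintype _ _ (by simp), Finsupp.sum_fintype _ _ (by simp),
    Fin.sum_univ_add, Fin.sum_univ_add, Fin.sum_univ_two, Fin.sum_univ_two]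
  have hA : ∀ i : Fin r, curveExp e (Fin.castAdd 2 i) • W' (Fin.castAdd 2 i) = e (Fin.castAdd 2 i) * W' (Fin.castAdd 2 i) := fun i => by
    rw [curveExp_of_ne e (castAdd_ne_u1 i), smul_eq_mul]
  have hB : ∀ i : Fin r, e (Fin.castAdd 2 i) • curvePullbackWeight W' (Fin.castAdd 2 i) =
      e (Fin.castAdd 2 i) * W' (Fin.castAdd 2 i) + e (Fin.castAdd 2 i) * W' (u1 r) := fun i => by
    rw [curvePullbackWeight_y, smul_eq_mul, mul_add]
  simp only [hA, hB, Finset.sum_add_distrib, smul_eq_mul]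
  have hu1 : (Fin.natAdd r 0 : Fin (r + 2)) = u1 r := rfl
  have hu2 : (Fin.natAdd r 1 : Fin (r + 2)) = u2 r := rfl
  rw [hu1, hu2, curveExp_u1, curveExp_of_ne e (Ne.symm u1_ne_u2), curvePullbackWeight_u1, curvePullbackWeight_u2, ydeg,
    ← Finset.sum_mul]
  ring

include hcy hc1 hc2 in
/-- The curve chart on monomials: `φ(c^e) = c′^{curveExp e}`. [cite: CossartJannsenSaito2020, (12.5)] -/
theorem map_cmonom_curveChart (e : Fin (r + 2) →₀ ℕ) : φ (cmonom c e) = cmonom c' (curveExp e) := by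
  rw [cmonom_eq_yPart_mul, cmonom_eq_yPart_mul, map_mul, map_mul, map_prod, map_pow, map_pow, ← hc1, ← hc2, curveExp_u1,
    curveExp_of_ne e (Ne.symm u1_ne_u2), pow_add, ydeg, ← Finset.prod_pow_eq_pow_sum]
  have hprod : ∏ i : Fin r, φ (c (Fin.castAdd 2 i) ^ e (Fin.castAdd 2 i)) =
      (∏ i : Fin r, c' (Fin.castAdd 2 i) ^ curveExp e (Fin.castAdd 2 i)) * ∏ i : Fin r, c' (u1 r) ^ e (Fin.castAdd 2 i) := by
    rw [← Finset.prod_mul_distrib]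
    refine Finset.prod_congr rfl fun i _ => ?_
    rw [map_pow, hcy i, ← hc1, curveExp_of_ne e (castAdd_ne_u1 i), mul_pow, mul_comm]
  rw [hprod]
  ring

include hcy hc1 hc2 in
/-- `φ(F^{(W)}_ρ) ⊆ F′^{(W′)}_ρ` for the pulled-back weight of the curve chart. [cite: CossartJannsenSaito2020, Lemma 12.4] -/
theorem map_weightedOrderIdeal_le_curve (ρ : ℕ) :
    (weightedOrderIdeal c (curvePullbackWeight W') ρ).map φ ≤ weightedOrderIdeal c' W' ρ := by
  rw [weightedOrderIdeal, Ideal.map_span, Ideal.span_le]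
  rintro _ ⟨_, ⟨e, he, rfl⟩, rfl⟩
  rw [SetLike.mem_coe, map_cmonom_curveChart φ hcy hc1 hc2]
  exact cmonom_mem_weightedOrderIdeal c' W' (by rwa [weight_curveExp])

/-- The exponent of the weak transform: `e` with `e_{u₁} ↦ |e|_y + e_{u₁} − μ`. [cite: CossartJannsenSaito2020, (12.5)] -/
def curvePt (μ : ℕ) (e : Fin (r + 2) →₀ ℕ) : Fin (r + 2) →₀ ℕ :=
  Finsupp.equivFunOnFinite.symm fun i => if i = u1 r then ydeg e + e (u1 r) - μ else e i

/-- Components. [cite: CossartJannsenSaito2020, (12.5)] -/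
theorem curvePt_u1 (μ : ℕ) (e : Fin (r + 2) →₀ ℕ) : curvePt μ e (u1 r) = ydeg e + e (u1 r) - μ := by simp [curvePt]

/-- Components. [cite: CossartJannsenSaito2020, (12.5)] -/
theorem curvePt_of_ne (μ : ℕ) (e : Fin (r + 2) →₀ ℕ) {i : Fin (r + 2)} (h : i ≠ u1 r) : curvePt μ e i = e i := by
  simp [curvePt, h]

/-- The y-degree is unchanged by `curvePt`. [cite: CossartJannsenSaito2020, (12.5)] -/
theorem ydeg_curvePt (μ : ℕ) (e : Fin (r + 2) →₀ ℕ) : ydeg (curvePt μ e) = ydeg e :=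
  Finset.sum_congr rfl fun i _ => curvePt_of_ne μ e (castAdd_ne_u1 i)

/-- `curvePt μ e + μ δ_{u₁} = curveExp e` when `|e|_y + e_{u₁} ≥ μ`. [cite: CossartJannsenSaito2020, (12.5)] -/
theorem curvePt_add_single {μ : ℕ} {e : Fin (r + 2) →₀ ℕ} (he : μ ≤ ydeg e + e (u1 r)) :
    curvePt μ e + Finsupp.single (u1 r) μ = curveExp e := by
  ext i
  by_cases hi : i = u1 r
  · subst hi
    rw [Finsupp.add_apply, curvePt_u1, Finsupp.single_eq_same, curveExp_u1]
    omega
  · have hs : Finsupp.single (u1 r) μ i = 0 := by simp [hi]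
    rw [Finsupp.add_apply, curvePt_of_ne μ e hi, hs, curveExp_of_ne e hi, add_zero]

/-- `curvePt μ` is injective on `{|e|_y + e_{u₁} ≥ μ}`. [cite: CossartJannsenSaito2020, (12.5)] -/
theorem curvePt_injOn {μ : ℕ} {e e' : Fin (r + 2) →₀ ℕ} (he : μ ≤ ydeg e + e (u1 r)) (he' : μ ≤ ydeg e' + e' (u1 r))
    (h : curvePt μ e = curvePt μ e') : e = e' := by
  have := congrArg (fun m => m + Finsupp.single (u1 r) μ) h
  simp only [curvePt_add_single he, curvePt_add_single he'] at this
  exact curveExp_injective this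

/-- `⟨W′, curvePt μ e⟩ + μ W′_{u₁} = ⟨W, e⟩`. [cite: CossartJannsenSaito2020, (12.5)] -/
theorem weight_curvePt_add {μ : ℕ} {e : Fin (r + 2) →₀ ℕ} (he : μ ≤ ydeg e + e (u1 r)) :
    Finsupp.weight W' (curvePt μ e) + μ * W' (u1 r) = Finsupp.weight (curvePullbackWeight W') e := by
  rw [← weight_curveExp, ← curvePt_add_single he, map_add]
  congr 1
  rw [Finsupp.weight_apply, Finsupp.sum_single_index (by simp), smul_eq_mul]

/-- The scale factor is unchanged by `curvePt`. [cite: CossartJannsenSaito2020, Lemma 12.4 (4)] -/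
theorem sfac_curvePt (μ : ℕ) (e : Fin (r + 2) →₀ ℕ) : sfac μ (curvePt μ e) = sfac μ e := by
  rw [sfac, sfac, ydeg_curvePt]

/-- Ordinate unchanged: `spt₂ (curvePt μ e) = spt₂ e`. [cite: CossartPiltant2008, p. 11] -/
theorem spt₂_curvePt (μ : ℕ) (e : Fin (r + 2) →₀ ℕ) : spt₂ μ (curvePt μ e) = spt₂ μ e := by
  rw [spt₂, spt₂, sfac_curvePt, curvePt_of_ne μ e (Ne.symm u1_ne_u2)]

/-- Abscissa translated by one unit: `spt₁ (curvePt μ e) + L = spt₁ e`. [cite: CossartJannsenSaito2020, Lemma 12.4 (4)] [cite: CossartPiltant2008, p. 11] -/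
theorem spt₁_curvePt_add {μ : ℕ} {e : Fin (r + 2) →₀ ℕ} (he₀ : ydeg e < μ) (he : μ ≤ ydeg e + e (u1 r)) :
    spt₁ μ (curvePt μ e) + μ.factorial = spt₁ μ e := by
  rw [spt₁, spt₁, sfac_curvePt, curvePt_u1, ← sub_mul_sfac he₀, ← add_mul]
  congr 1
  omega

include hcy in
/-- `φ((y, u₁)^μ) R′ ⊆ ((φ u₁)^μ)`: the exceptional divisor is principal in the chart. [cite: CossartJannsenSaito2020, Lemma 12.4 (1)] -/
theorem map_yu1Ideal_pow_le (μ : ℕ) : (yu1Ideal c ^ μ).map φ ≤ Ideal.span {φ (c (u1 r)) ^ μ} := by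
  rw [Ideal.map_pow, ← Ideal.span_singleton_pow]
  refine Ideal.pow_right_mono ?_ μ
  rw [yu1Ideal, Ideal.map_span, Ideal.span_le]
  rintro _ ⟨x, hx, rfl⟩
  rcases hx with rfl | ⟨i, rfl⟩
  · exact Ideal.subset_span rfl
  · rw [SetLike.mem_coe]
    change φ (c (Fin.castAdd 2 i)) ∈ _
    rw [hcy i]; exact Ideal.mul_mem_right _ _ (Ideal.subset_span rfl)

include hcy in
/-- Every `f ∈ (y, u₁)^μ` has `φ f = (φ u₁)^μ g`. [cite: CossartJannsenSaito2020, Lemma 12.4 (1)] -/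
theorem exists_eq_pow_mul_of_mem_pPow {μ : ℕ} {f : R} (hf : f ∈ yu1Ideal c ^ μ) : ∃ g : R', φ f = φ (c (u1 r)) ^ μ * g := by
  have := map_yu1Ideal_pow_le φ hcy μ (Ideal.mem_map_of_mem _ hf)
  obtain ⟨g, hg⟩ := Ideal.mem_span_singleton'.mp this
  exact ⟨g, by rw [← hg, mul_comm]⟩

section Descend

variable [IsRegularLocalRing R'] (hgen' : Ideal.span (Set.range c') = maximalIdeal R') (hdim' : ringKrullDim R' = r + 2)
  (hW' : ∀ i, 0 < W' i)

include hcy hc1 hc2 hgen' hdim' hW' in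
/-- **Containments descend to the weak transform** (curve chart): `J ⊆ F^{(W)}_{ρ′ + μ W′_{u₁}}` for the pulled-back weight implies
`(J R′ : (φ u₁)^μ) ⊆ F′^{(W′)}_{ρ′}`. [cite: CossartJannsenSaito2020, Lemma 12.4 (4)] [cite: CossartPiltant2008, Lemma 4.5 (1)] -/
theorem colon_le_weightedOrderIdeal_of_le_curve {J : Ideal R} {μ ρ' : ℕ}
    (hJ : J ≤ weightedOrderIdeal c (curvePullbackWeight W') (ρ' + μ * W' (u1 r))) :
    (J.map φ).colon {φ (c (u1 r)) ^ μ} ≤ weightedOrderIdeal c' W' ρ' := by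
  intro g hg
  rw [Submodule.mem_colon_singleton, smul_eq_mul, mul_comm] at hg
  have h1' : φ (c (u1 r)) ^ μ * g ∈ weightedOrderIdeal c' W' (ρ' + μ * W' (u1 r)) :=
    map_weightedOrderIdeal_le_curve φ hcy hc1 hc2 W' _ (Ideal.map_mono hJ hg)
  have hmon : φ (c (u1 r)) ^ μ = cmonom c' (Finsupp.single (u1 r) μ) := by rw [cmonom_single_pow, hc1]
  have hwt : Finsupp.weight W' (Finsupp.single (u1 r) μ) = μ * W' (u1 r) := by
    rw [Finsupp.weight_apply, Finsupp.sum_single_index (by simp), smul_eq_mul]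
  refine mem_weightedOrderIdeal_of_cmonom_mul_mem c' hgen' hdim' hW' (Finsupp.single (u1 r) μ) ?_
  rwa [hwt, ← hmon]

end Descend

section Up

variable [IsRegularLocalRing R] [IsRegularLocalRing R']
  (hgen : Ideal.span (Set.range c) = maximalIdeal R) (hdim : ringKrullDim R = r + 2)
  (hgen' : Ideal.span (Set.range c') = maximalIdeal R') (hdim' : ringKrullDim R' = r + 2)
  (hW' : ∀ i, 0 < W' i)

include hcy hc1 hc2 hgen hdim hgen' hdim' hW' in
/-- **Initial terms go up** (curve chart): if `f ∈ (y, u₁)^μ` has the initial unit term `e` for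
the pulled-back weight `W` and `φ f = (φ u₁)^μ g`, then `curvePt μ e` is a `W′`-initial unit
term of `g`. [cite: CossartJannsenSaito2020, Lemma 12.4 (4)] [cite: CossartPiltant2008, Lemma 4.5 (1)] -/
theorem isInitialTerm_curveChart {μ : ℕ} {f : R} (hfμ : f ∈ yu1Ideal c ^ μ)
    {e : Fin (r + 2) →₀ ℕ} (he : IsInitialTerm c (curvePullbackWeight W') f e) {g : R'}
    (hg : φ f = φ (c (u1 r)) ^ μ * g) : IsInitialTerm c' W' g (curvePt μ e) := by
  classical
  have hW : ∀ i, 0 < curvePullbackWeight W' i := curvePullbackWeight_pos hW'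
  -- a relative unit representative of `f` with monomials in `{e₀ + e₁ ≥ μ}`
  set K := Finsupp.weight (curvePullbackWeight W') e + μ * W' (u1 r) + 1 with hK
  have hfK : ∀ K, f ∈ weightedOrderIdeal c (wK1 r K) (K * μ) := fun K =>
    yu1Ideal_pow_le_weightedOrderIdeal c μ K hfμ
  obtain ⟨F, hFu, hFsupp, hFrem⟩ := exists_unitRep_pPow c hgen hdim hW hfK K
  obtain ⟨heF, hmin⟩ := (isInitialTerm_iff_of_unitRep c hgen hdim hW hFu hFrem (by omega)).mp he
  -- the transported representative
  set G : MvPolynomial (Fin (r + 2)) R' := ∑ m ∈ F.support, monomial (curvePt μ m) (φ (F.coeff m))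
    with hG
  have hGcoeff : ∀ m ∈ F.support, G.coeff (curvePt μ m) = φ (F.coeff m) := by
    intro m hm
    rw [hG, coeff_sum, Finset.sum_eq_single m]
    · rw [coeff_monomial, if_pos rfl]
    · intro m' hm' hne
      rw [coeff_monomial, if_neg]
      exact fun h' => hne (curvePt_injOn (hFsupp m' hm') (hFsupp m hm) h')
    · intro hm'; exact absurd hm hm'
  have hGsupp : ∀ n ∈ G.support, ∃ m ∈ F.support, n = curvePt μ m := by
    intro n hn
    rw [hG] at hn
    obtain ⟨m, hm, hmn⟩ := Finset.mem_biUnion.mp (support_sum hn)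
    exact ⟨m, hm, Finset.mem_singleton.mp (support_monomial_subset hmn)⟩
  have hGu : HasUnitCoeffs G := by
    intro n hn
    obtain ⟨m, hm, rfl⟩ := hGsupp n hn
    rw [hGcoeff m hm]
    exact (hFu m hm).map φ
  have hGeval : φ (c (u1 r)) ^ μ * eval c' G = φ (eval c F) := by
    conv_rhs => rw [F.as_sum, map_sum, map_sum]
    rw [hG, map_sum, Finset.mul_sum]
    refine Finset.sum_congr rfl fun m hm => ?_
    rw [eval_monomial_eq_cmonom, eval_monomial_eq_cmonom, map_mul, map_cmonom_curveChart φ hcy hc1 hc2,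
      ← curvePt_add_single (hFsupp m hm), cmonom_add]
    have : cmonom c' (Finsupp.single (u1 r) μ) = φ (c (u1 r)) ^ μ := by rw [cmonom_single_pow, hc1]
    rw [this]; ring
  -- `g - G(c′) ∈ F′_{K − μ W′₁}` by division
  have hdiff : g - eval c' G ∈ weightedOrderIdeal c' W' (K - μ * W' (u1 r)) := by
    have hmem : φ (c (u1 r)) ^ μ * (g - eval c' G) ∈ weightedOrderIdeal c' W' K := by
      rw [mul_sub, ← hg, hGeval, ← map_sub]
      exact map_weightedOrderIdeal_le_curve φ hcy hc1 hc2 W' K (Ideal.mem_map_of_mem _ hFrem)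
    have hmon : φ (c (u1 r)) ^ μ = cmonom c' (Finsupp.single (u1 r) μ) := by rw [cmonom_single_pow, hc1]
    have hwt : Finsupp.weight W' (Finsupp.single (u1 r) μ) = μ * W' (u1 r) := by
      rw [Finsupp.weight_apply, Finsupp.sum_single_index (by simp), smul_eq_mul]
    refine mem_weightedOrderIdeal_of_cmonom_mul_mem c' hgen' hdim' hW' (Finsupp.single (u1 r) μ) ?_
    rw [hwt, ← hmon, Nat.sub_add_cancel (by omega)]
    exact hmem
  have hwt : Finsupp.weight W' (curvePt μ e) + μ * W' (u1 r) =
      Finsupp.weight (curvePullbackWeight W') e := weight_curvePt_add W' (hFsupp e heF)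
  refine (isInitialTerm_iff_of_unitRep c' hgen' hdim' hW' hGu hdiff (by omega)).mpr ⟨?_, ?_⟩
  · rw [mem_support_iff, hGcoeff e heF]
    exact ((hFu e heF).map φ).ne_zero
  · intro n hn
    obtain ⟨m, hm, rfl⟩ := hGsupp n hn
    have h1 := hmin m hm
    have h2 := weight_curvePt_add W' (hFsupp m hm)
    omega

include hcy hc1 hc2 hgen hdim hgen' hdim' hW' in
/-- **Newton points go up** (curve chart): if `e ∈ pts c J μ` is an initial unit term of some
`f ∈ J ⊆ (y, u₁)^μ` for the pull-back of the positive weight `W′`, then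
`curvePt μ e ∈ pts c′ J′ μ`, `J′ = (J R′ : (φ u₁)^μ)`. [cite: CossartJannsenSaito2020, Lemma 12.4 (4)] -/
theorem curvePt_mem_pts {J : Ideal R} {μ : ℕ} (hJμ : J ≤ yu1Ideal c ^ μ) {f : R}
    (hf : f ∈ J) {e : Fin (r + 2) →₀ ℕ} (he₀ : ydeg e < μ)
    (he : IsInitialTerm c (curvePullbackWeight W') f e) :
    curvePt μ e ∈ pts c' ((J.map φ).colon {φ (c (u1 r)) ^ μ}) μ := by
  obtain ⟨g, hg⟩ := exists_eq_pow_mul_of_mem_pPow φ hcy (hJμ hf)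
  refine ⟨⟨g, ?_, W', hW', isInitialTerm_curveChart φ hcy hc1 hc2 W' hgen hdim hgen' hdim' hW'
    (hJμ hf) he hg⟩, by rw [ydeg_curvePt]; exact he₀⟩
  rw [Submodule.mem_colon_singleton, smul_eq_mul, mul_comm, ← hg]
  exact Ideal.mem_map_of_mem _ hf

end Up

end CurveChart

end WeightedOrder

end Literature.AlgebraicGeometry.Resolution

end
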